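import Summits.ResolutionOfSingularities.ResolutionOfSingularities.Theorems.ValuativeLuAlphaPTorsorModelDerivations
import Literature.AlgebraicGeometry.Resolution.LocalBlowup

/-!
# Derivation infrastructure on `locAtCentre A O`, the local ring of a model inside `K`

Helper file for the line `pfaff-line-log-final-forms` of the crux `Valuative.LuAlphaPTorsor`
(item `stmt-ResolutionOfSingularities-0641`), sub-goals T2a/T2b of the lead's skeleton.

Setting: `k ⊆ K` fields, `char k = p`, `O` a valuation ring of `K`, `A ⊆ O` a finitely generated
`k`-subalgebra of `K`. The line runs Giraud's induction along the quadratic sequence of the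
regular base INSIDE `K`, in the tree vocabulary `locAtCentre B O ⊆ K` (`LocalBlowup.lean`: the
fractions `y / z`, `y, z ∈ B`, `ν(z) = 0`), while the two facts about `ℤ`-derivations it needs —
**richness** (`rich_localization_centre`) and **dual derivations of a regular system of
parameters** (`exists_dual_derivations_centre`, both in `…ModelDerivations.lean`) — were landed
for the isomorphic abstract local ring `Localization.AtPrime (𝔪_O ∩ A)`. Here they are
transported along the ring isomorphism
`locAtCentreEquiv h : Localization.AtPrime (𝔪_O ∩ A) ≃ locAtCentre A O` (`LocalBlowup.lean`):

* `exists_derivation_transport_ringEquiv` — a `ℤ`-derivation `D` of `L` and a ring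
  isomorphism `e : L ≃ L'` give a `ℤ`-derivation `D' = e ∘ D ∘ e⁻¹` of `L'` (for ARBITRARY
  `Algebra ℤ` structures on both sides: the one on a localisation is not the canonical one);
* `rich_locAtCentre` (T2a) and `exists_dual_derivations_locAtCentre` (T2b) — the transported
  statements.
-/

set_option linter.dupNamespace false

namespace Summit.ResolutionOfSingularities.ResolutionOfSingularities.Theorems.PfaffLine

open IsLocalRing Literature.AlgebraicGeometry.Resolution

/-! ## Transport of `ℤ`-derivations along ring isomorphisms -/

/-- **Transport of a `ℤ`-derivation along a ring isomorphism.** For `e : L ≃ L'` and a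
`ℤ`-derivation `D` of `L`, `D' := e ∘ D ∘ e⁻¹` is a `ℤ`-derivation of `L'`, i.e.
`D' (e x) = e (D x)`. Stated for arbitrary `Algebra ℤ` instances on `L` and `L'` (a `ℤ`-derivation
is just an additive map satisfying Leibniz). [folklore] -/
theorem exists_derivation_transport_ringEquiv {L L' : Type*} [CommRing L] [CommRing L']
    [Algebra ℤ L] [Algebra ℤ L'] (e : L ≃+* L') (D : Derivation ℤ L L) :
    ∃ D' : Derivation ℤ L' L', ∀ x, D' (e x) = e (D x) := by
  -- `e ∘ D ∘ e⁻¹`, `ℤ`-linear for the scalar actions underlying `Derivation ℤ L' L'` (source: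
  -- the given `Algebra ℤ L'`; target: the canonical `ℤ`-module structure)
  let φ := @LinearMap.mk ℤ ℤ _ _ (RingHom.id ℤ) L' L' _ _ Algebra.toModule _
    { toFun := fun y => e (D (e.symm y))
      map_add' := fun a b => by simp only [map_add] }
    (fun c y => by
      simp only [RingHom.id_apply]
      rw [Algebra.smul_def c y, map_mul, eq_intCast (algebraMap ℤ L') c, map_intCast e.symm c,
        Derivation.leibniz, Derivation.map_intCast, smul_zero, add_zero, smul_eq_mul, map_mul,
        map_intCast e c, zsmul_eq_mul])
  have hφ : ∀ y, φ y = e (D (e.symm y)) := fun _ => rfl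
  refine ⟨Derivation.mk' φ (fun a b => ?_), fun x => ?_⟩
  · rw [hφ, hφ, hφ, map_mul, Derivation.leibniz, map_add, smul_eq_mul, smul_eq_mul, map_mul,
      map_mul, e.apply_symm_apply, e.apply_symm_apply, smul_eq_mul, smul_eq_mul]
  · rw [Derivation.coe_mk', hφ, e.symm_apply_apply]

/-! ## The registered sub-goals -/

/-- **T2a, richness of `Der_ℤ` of `locAtCentre A O`.** For `A ⊆ O` a finitely generated
`k`-subalgebra (`char k = p`), regular at the centre `𝔭 = 𝔪_O ∩ A`, and
`R = locAtCentre A O ⊆ K` its local ring at the centre: every `ψ`-derivation `δ₀ : R → N` is,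
on a finite set `Y`, a finite combination `δ₀ y = ∑_j ψ(Δ_j y) n_j` of `ℤ`-derivations `Δ_j`
of `R`. Transport of `rich_localization_centre` along `locAtCentreEquiv`. [folklore] -/
theorem rich_locAtCentre : ∀ (p : ℕ) [Fact p.Prime] (k K : Type) [Field k] [CharP k p] [Field K] [Algebra k K] (O : ValuationSubring K) (A : Subalgebra k K) (h : A.toSubring ≤ O.toSubring), A.FG → IsRegularLocalRing (Localization.AtPrime (Ideal.comap (Subring.inclusion h) (IsLocalRing.maximalIdeal O))) → ∀ (N : Type) [CommRing N] (ψ : Literature.AlgebraicGeometry.Resolution.locAtCentre A.toSubring O →+* N) (δ₀ : Literature.AlgebraicGeometry.Resolution.locAtCentre A.toSubring O →+ N), (∀ a b, δ₀ (a * b) = ψ a * δ₀ b + ψ b * δ₀ a) → ∀ Y : Finset (Literature.AlgebraicGeometry.Resolution.locAtCentre A.toSubring O), ∃ (m : ℕ) (Δ : Fin m → Derivation ℤ (Literature.AlgebraicGeometry.Resolution.locAtCentre A.toSubring O) (Literature.AlgebraicGeometry.Resolution.locAtCentre A.toSubring O)) (nn : Fin m → N), ∀ y ∈ Y, δ₀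 y = Finset.univ.sum fun j => ψ (Δ j y) * nn j := by
  intro p _ k K _ _ _ _ O A h hfg hreg N _ ψ δ₀ hleib Y
  classical
  -- the ring isomorphism `A_𝔭 ≃ locAtCentre A O`
  let e : Localization.AtPrime (Ideal.comap (Subring.inclusion h) (IsLocalRing.maximalIdeal O)) ≃+*
      locAtCentre A.toSubring O := (locAtCentreEquiv h).toRingEquiv
  -- pull the data back to `A_𝔭`
  have hleib' : ∀ a b, (δ₀.comp e.toRingHom.toAddMonoidHom) (a * b) =
      (ψ.comp e.toRingHom) a * (δ₀.comp e.toRingHom.toAddMonoidHom) b +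
        (ψ.comp e.toRingHom) b * (δ₀.comp e.toRingHom.toAddMonoidHom) a := fun a b => by
    show δ₀ (e (a * b)) = ψ (e a) * δ₀ (e b) + ψ (e b) * δ₀ (e a)
    rw [map_mul]
    exact hleib _ _
  obtain ⟨m, Δ, nn, hΔ⟩ := rich_localization_centre p k K O A h hfg hreg N (ψ.comp e.toRingHom)
    (δ₀.comp e.toRingHom.toAddMonoidHom) hleib' (Y.image e.symm)
  -- transport the derivations
  choose Δ' hΔ' using fun j => exists_derivation_transport_ringEquiv e (Δ j)
  refine ⟨m, Δ', nn, fun y hy => ?_⟩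
  have H : δ₀ (e (e.symm y)) = Finset.univ.sum fun j => ψ (e (Δ j (e.symm y))) * nn j :=
    hΔ (e.symm y) (Finset.mem_image_of_mem _ hy)
  rw [e.apply_symm_apply] at H
  rw [H]
  refine Finset.sum_congr rfl fun j _ => ?_
  rw [← hΔ' j (e.symm y), e.apply_symm_apply]

/-- **T2b, dual derivations for a regular system of parameters of `locAtCentre A O`.** For
`A ⊆ O` a finitely generated `k`-subalgebra with `R = locAtCentre A O` regular and `u_1, …, u_d`
generators of `𝔪_R`, `d = dim R`: there are `ℤ`-derivations `D_1, …, D_d` of `R` with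
`D_i u_j = δ_ij`. Transport of `exists_dual_derivations_centre` along `locAtCentreEquiv`
(maximal ideals and Krull dimension are preserved by ring isomorphisms). [folklore] -/
theorem exists_dual_derivations_locAtCentre : ∀ (p : ℕ) [Fact p.Prime] (k K : Type) [Field k] [CharP k p] [Field K] [Algebra k K] (O : ValuationSubring K) (A : Subalgebra k K) (h : A.toSubring ≤ O.toSubring), A.FG → ∀ [IsRegularLocalRing (Literature.AlgebraicGeometry.Resolution.locAtCentre A.toSubring O)] {d : ℕ} (u : Fin d → Literature.AlgebraicGeometry.Resolution.locAtCentre A.toSubring O), Ideal.span (Set.range u) = IsLocalRing.maximalIdeal (Literature.AlgebraicGeometry.Resolution.locAtCentre A.toSubring O) → ringKrullDim (Literature.AlgebraicGeometry.Resolution.locAtCentre A.toSubring O) = (d : WithBot ℕ∞) → ∃ D : Fin d → Derivation ℤ (Literature.AlgebraicGeometry.Resolution.locAtCentre A.toSubring O) (Literature.AlgebraicGeometry.Resolution.locAtCentre A.toSubring O), ∀ i j, D i (u j) = if i = j then 1 else 0 := by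
  intro p _ k K _ _ _ _ O A h hfg hreg' d u hspan hdim
  -- the ring isomorphism `A_𝔭 ≃ locAtCentre A O`
  let e : Localization.AtPrime (Ideal.comap (Subring.inclusion h) (IsLocalRing.maximalIdeal O)) ≃+*
      locAtCentre A.toSubring O := (locAtCentreEquiv h).toRingEquiv
  have hreg : IsRegularLocalRing
      (Localization.AtPrime (Ideal.comap (Subring.inclusion h) (IsLocalRing.maximalIdeal O))) :=
    IsRegularLocalRing.of_ringEquiv e.symm
  -- pull the regular system of parameters back to `A_𝔭`
  have hspan' : Ideal.span (Set.range (e.symm ∘ u)) = maximalIdeal _ := by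
    rw [Set.range_comp, ← Ideal.map_span, hspan, map_ringEquiv_maximalIdeal]
  have hdim' : ringKrullDim
      (Localization.AtPrime (Ideal.comap (Subring.inclusion h) (IsLocalRing.maximalIdeal O))) =
        (d : WithBot ℕ∞) := (ringKrullDim_eq_of_ringEquiv e).trans hdim
  obtain ⟨D, hD⟩ := exists_dual_derivations_centre p k K O A h hfg hreg (e.symm ∘ u) hspan' hdim'
  -- transport the derivations
  choose D' hD' using fun i => exists_derivation_transport_ringEquiv e (D i)
  refine ⟨D', fun i j => ?_⟩
  have H := hD' i (e.symm (u j))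
  rw [e.apply_symm_apply] at H
  rw [H, show D i (e.symm (u j)) = if i = j then 1 else 0 from hD i j]
  split_ifs <;> simp
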